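import Summits.QuantumFields.BalabanUV.Beta.FP.TowerDoorUniformDataNested
import Summits.QuantumFields.BalabanUV.Beta.FP.QstepSymTwoBlock
import Summits.QuantumFields.BalabanUV.Beta.FP.TorusNestedGaugeReadout

/-!
# `BalabanUV.Beta.FP.TowerDoorUniformDataWrapper` — binder row D1, the row's ONE file, LEMMA U ON THE TORUS AT THE END WRAPPER's PINS:
# **`lv n B 𝟙_μ = 0` — the tree-gauge function of UNIFORM data vanishes on every box**, composed BY NAME from road g53 (D) `TorusNestedGaugeReadout.gaugeParam_eq_neg_nestedReadout_sym`
# (the gauge parameter is a nested-slice read-out of the one-shot column), road g54 (B) `QstepSymTwoBlock.QSym_twoBlock` ((TB) at the record's `QSym`), and the row's PART 53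
# `TowerDoorUniformDataNested.gaugeParam_uniform_eq_zero` (U1 torus + U2); what stays displayed is exactly what (D)∕(A2)∕(B) display: g39's pins, the two nested KKT
# non-degeneracies `h1 h2`, leaf-06 G-2's `det (N·W₀) ≠ 0`, and the leg letters `hLN hEAN hfN`
# (β-function cell `pub-balaban`, BINDER-OWNERS row D1 ∕ (C1) OWNER «beta-an2» gen 76, PART 54; imports PART 53 + road (B) + road (D))

WHY (located; J-NOTE-20 §7; K2L-LAM by value: Λ_μ constant 4∕4 — here the constant is 0, as a theorem).  §1 the `…_sym` forms of PART 53 with (TB) DISCHARGED (`hQ₁₀ : Q₁₀ = compRowsSym …`, as (B) §RecordReadout);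
§2 **`gaugeParam_uniform_eq_zero_at_pins`**: at (D) §2's binders VERBATIM (`d = 3`, top torus `M′` with `Lc ∣ M′ i` and `M′ = Lc • Mc` displayed as `hMc`, the record's chart `scaleK σ σ (AN R (n+1))` in the leg),
`(P·W₀)⁻¹ *ᵥ (P *ᵥ hv 𝟙_μ) = 0`; **`lv_uniform_eq_zero_at_pins`**: with v10's `hlve`-shaped read-out DISPLAYED as a letter `hlve`, `lv 𝟙_μ s = 0` at every finest site.
WHAT THIS IS NOT: not the lattice `hΘ` ((P-c)); `hc0`∕`det` (G-2's input), `h1 h2`, the leg letters and g39's pins remain DISPLAYED (their dischargers are the wrapper's ∕ leaf-06's ∕ road's, by name); the door NOT defined;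
nothing of Bałaban's asserted, valued or discharged; 0 estimates; 0∕4 row-D1 binders (hW, hR, D1Tel, D1Rep); v10 NOT filed; v9 p617999 stands; NOT (C1), NOT (T-ID), NOT D1, NEVER «G-an2-4 closed», NOT BetaPertH,
NOT continuum, NOT Clay.

HONEST DEPENDENCY (page 1, mandatory): continuum YM on T⁴ ⇐ BetaPertH ∧ nine spine estimates (0/9 proved); BetaPertH ⇐ (D1) ∧ (D4) ∧ CAP+tail;
G-an2-4 gates asym, D1 and NE2/3/4.  HONEST FRAMING (cell contract, verbatim): «discharging `BetaPertH` makes Bałaban's UV stability UNCONDITIONAL —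
a real constructive-QFT result; it is NOT the continuum limit and NOT the Clay problem.»  ABSOLUTE RULE (cell charter, verbatim): «No internally-minted
statement may enter as a cited fact. Every hypothesis is either kernel-proved in this package or a verbatim quotation of a PUBLISHED theorem with page
reference. The manuscript(s) under audit are NOT citable for their own disputed steps — they are the thing under adjudication; programme-internal
(2001/route/tribunal) claims are never citable.»  Row D1 ∕ (C1) OWNER «beta-an2» gen 76, 2026-08-29.  No existing file touched.
-/

noncomputable section

open Finset Matrix
open scoped BigOperators
open Literature.Probability.LatticeModels (Torus.proj)
open Literature.MathematicalPhysics.QuantumFieldTheory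
open Literature.MathematicalPhysics.QuantumFieldTheory.Balaban1983to89
open Literature.MathematicalPhysics.QuantumFieldTheory.Balaban1983to89.Beta
open Literature.MathematicalPhysics.QuantumFieldTheory.Balaban1983to89.Beta.Composition (kkt)
open Literature.MathematicalPhysics.QuantumFieldTheory.Balaban1983to89.Beta.CompositionSingular (effForm minOp)
open B5Prop11Plancherel (fine)
open B6Lemma24Torus (pbox)
open AffineAveraging (Site box toSite unitVec)
open AveragingContoursRooted (ctrOff ctrOff_mem_box)
open OneStepResolventKernel (Fib)
open ExpKernelCalculus (MKer)
open HessKerRate (scaleK)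
open Literature.MathematicalPhysics.QuantumFieldTheory.LatticeForm (quo)
open Summit.QuantumFields.BalabanUV.Beta.AxialDressingRooted (axEc)
open Summit.QuantumFields.BalabanUV.Beta.SymShiftedSpread (bhKStepSh)
open Summit.QuantumFields.BalabanUV.Beta.BorderedHessian (bhKStepAt)
open Summit.QuantumFields.BalabanUV.Beta.DshAn1 (Dsh)
open Summit.QuantumFields.BalabanUV.Beta.CompositeOneShotJetData (Roots AN)
open Summit.QuantumFields.BalabanUV.Beta.FP.KernelPeriodisationFib (Idx perF)
open Summit.QuantumFields.BalabanUV.Beta.FP.TorusGaugeCovariancePairing (wrapPt)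
open Summit.QuantumFields.BalabanUV.Beta.FP.TorusCombRows (Res)
open Summit.QuantumFields.BalabanUV.Beta.FP.TorusCompositeObjects (towerTorus towerTorus_apply NParam combF bigP towerGen bigRoot bigRatio bigRatio_eq_pow towerEquiv)
open Summit.QuantumFields.BalabanUV.Beta.FP.TorusCompositeObjectsG (StepRows QSym compRowsG compRowsSym)
open Summit.QuantumFields.BalabanUV.Beta.FP.TorusCompositeUnimodular (towerEvalC)
open Summit.QuantumFields.BalabanUV.Beta.GAN24.FineReadoutCauchyFrame (toSite_mem_range)
open Summit.QuantumFields.BalabanUV.Beta.FP.QstepSymTwoBlock (QSym_twoBlock)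
open Summit.QuantumFields.BalabanUV.Beta.FP.TorusNestedGaugeReadout (gaugeParam_eq_neg_nestedReadout_sym)
open Summit.QuantumFields.BalabanUV.Beta.FP.TowerDoorUniformDataNested (gaugeParam_uniform_eq_zero treeGauge_readout_uniform_eq_zero gaugeParam_eq_zero_of_mulVec_eq_zero nestedRows_mulVec_eq_zero_of_faceSupported)

namespace Summit.QuantumFields.BalabanUV.Beta.FP.TowerDoorUniformDataWrapper

/-! ## §1 PART 53 with (TB) discharged at the record's `QSym` -/

section Sym

variable {Lc : ℕ} [NeZero Lc] (R : Roots Lc) (j : ℕ) (M : Fin (3 + 1) → ℕ) [∀ μ, NeZero (M μ)] (lev : ℕ → ℕ) (rs : ℕ → (Fin (3 + 1) → ℕ))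
  (hrs : ∀ k i, 0 ≤ toSite (rs k) i ∧ toSite (rs k) i < (Lc : ℤ)) (hM : ∀ i, Lc ∣ M i) (n : ℕ)
include hM

/-- [folklore] **`gaugeParam_uniform_eq_zero_sym`** — PART 53 `gaugeParam_uniform_eq_zero` with `Q₁₀ = compRowsSym …` (the wrapper's composite averaging of record) and (TB) DISCHARGED by road (B)
`QSym_twoBlock`: the tree-gauge parameter of the uniform indicator vanishes. -/
theorem gaugeParam_uniform_eq_zero_sym (hLb : bigRatio Lc (n + 1) = Lc ^ (j + 1))
    (M' : Fin (3 + 1) → ℕ) [∀ i, NeZero (M' i)] (hT : ∀ i, towerTorus Lc M (n + 1) i = Lc ^ (j + 1) * M' i)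
    {Q₁₀ : Matrix (↥(pbox M) × Fin (3 + 1)) (↥(pbox (towerTorus Lc M (n + 1))) × Fin (3 + 1)) ℝ} (hQ₁₀ : Q₁₀ = compRowsSym Lc M lev rs (n + 1))
    {τ₁ : Matrix (NParam Lc (fine Lc M) (fun k => rs (k + 1)) n) (↥(pbox (towerTorus Lc M (n + 1))) × Fin (3 + 1)) ℝ}
    (hτ₁ : τ₁ = bigP Lc (fine Lc M) (fun k => rs (k + 1)) (fun k => hrs (k + 1)) n)
    {τ₂ : Matrix (Res (toSite (rs 0)) Lc M) (↥(pbox M) × Fin (3 + 1)) ℝ} (hτ₂ : τ₂ = combF Lc M (rs 0))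
    {N : Matrix (NParam Lc M rs (n + 1)) (↥(pbox (towerTorus Lc M (n + 1))) × Fin (3 + 1)) ℝ} (hN : N = Matrix.fromRows (τ₂ * Q₁₀) τ₁)
    {W₀ : Matrix (↥(pbox (towerTorus Lc M (n + 1))) × Fin (3 + 1)) (NParam Lc M rs (n + 1)) ℝ} (hTW : (N * W₀).det ≠ 0)
    {κs ρs : Type*} [Fintype κs] [Fintype ρs] (σ : Fib 3 → ℝ) (ρN : Site (3 + 1)) (LNc : ℕ) (fN : κs → Idx (towerTorus Lc M (n + 1)) (Fib 3))
    (slot : κs ≃ ↥(pbox M') × Fin (3 + 1))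
    (hfN : ∀ a : κs, fN a = (wrapPt (towerTorus Lc M (n + 1)) (((Lc ^ (j + 1) : ℕ) : ℤ) • ((slot a).1 : Site (3 + 1))), Sum.inr (slot a).2))
    {XN : Matrix ((↥(pbox (towerTorus Lc M (n + 1))) × Fin (3 + 1)) ⊕ (κs ⊕ ρs)) ((↥(pbox (towerTorus Lc M (n + 1))) × Fin (3 + 1)) ⊕ (κs ⊕ ρs)) ℝ}
    (hEAN : perF (towerTorus Lc M (n + 1)) (axEc ρN LNc) * perF (towerTorus Lc M (n + 1)) (scaleK σ σ (AN R j)) = perF (towerTorus Lc M (n + 1)) (scaleK σ σ (AN R j)))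
    (hLN : XN.submatrix (Sum.map id Sum.inl) (Sum.map id Sum.inl) = fromBlocks
      (Matrix.of fun (b b' : (↥(pbox (towerTorus Lc M (n + 1))) × Fin (3 + 1))) =>
        axEc ρN LNc (b.1 : Site (3 + 1)) (b.1 : Site (3 + 1)) (Sum.inl b.2) (Sum.inl b.2)
          * (axEc ρN LNc (b'.1 : Site (3 + 1)) (b'.1 : Site (3 + 1)) (Sum.inl b'.2) (Sum.inl b'.2)
            * perF (towerTorus Lc M (n + 1)) (scaleK σ σ (AN R j)) (b.1, Sum.inl b.2) (b'.1, Sum.inl b'.2)))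
      (Matrix.of fun (b : (↥(pbox (towerTorus Lc M (n + 1))) × Fin (3 + 1))) (a : κs) =>
        axEc ρN LNc (b.1 : Site (3 + 1)) (b.1 : Site (3 + 1)) (Sum.inl b.2) (Sum.inl b.2) * perF (towerTorus Lc M (n + 1)) (scaleK σ σ (AN R j)) (b.1, Sum.inl b.2) (fN a))
      (-Matrix.of fun (a : κs) (b : (↥(pbox (towerTorus Lc M (n + 1))) × Fin (3 + 1))) =>
        axEc ρN LNc (b.1 : Site (3 + 1)) (b.1 : Site (3 + 1)) (Sum.inl b.2) (Sum.inl b.2) * perF (towerTorus Lc M (n + 1)) (scaleK σ σ (AN R j)) (fN a) (b.1, Sum.inl b.2))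
      (-((perF (towerTorus Lc M (n + 1)) (scaleK σ σ (AN R j))).submatrix fN fN)))
    (μ : Fin (3 + 1)) {θ : NParam Lc M rs (n + 1) → ℝ}
    (hθ : (N * W₀) *ᵥ θ = -(N *ᵥ (XN.toBlocks₁₂ *ᵥ Sum.elim (fun a : κs => if (slot a).2 = μ then (1 : ℝ) else 0) (fun _ : ρs => 0)))) :
    θ = 0 :=
  gaugeParam_uniform_eq_zero R j (QSym Lc) (QSym_twoBlock Lc) M lev rs hrs hM n hLb M' hT hQ₁₀ hτ₁ hτ₂ hN hTW σ ρN LNc fN slot hfN hEAN hLN μ hθ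

end Sym

/-! ## §2 At (D) §2's pins: the gauge parameter and the tree-gauge function of uniform data vanish -/

section Pins

variable (M' : Fin (3 + 1) → ℕ) [∀ μ, NeZero (M' μ)] (Lc : ℕ) [NeZero Lc] (lev : ℕ → ℕ) (n : ℕ)

set_option synthInstance.maxSize 1024 in
/-- [folklore] **`gaugeParam_uniform_eq_zero_at_pins` — LEMMA U ON THE TORUS AT THE END WRAPPER's PINS**: binders = road g53 (D) `gaugeParam_eq_neg_nestedReadout_sym`'s VERBATIM (`d = 3`) + leaf-06 G-2's
`det ≠ 0` + the leg letters `hEAN hLN` for the record's chart `scaleK σ σ (AN R (n+1))` + the slot parametrisation `slot`∕`hfN` (v10's `hfN` shape) + the coarse box `Mc` with `M′ = Lc • Mc` (`hMc`);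
conclusion: the one-shot gauge parameter of the uniform indicator of direction `μ` VANISHES — `(P·W₀)⁻¹ *ᵥ (P *ᵥ hv 𝟙_μ) = 0`. -/
theorem gaugeParam_uniform_eq_zero_at_pins (R : Roots Lc)
    (hrs : ∀ _k : ℕ, ctrOff (3 + 1) Lc ∈ box (3 + 1) Lc)
    (hlev : ∀ i, i ≤ n → lev i = lev (i + 1) + 1) (hM' : ∀ i, Lc ∣ M' i)
    {κ : Type*} [Fintype κ] [DecidableEq κ] (pμ' : κ → ↥(pbox M')) (mμ' : κ → Fin (3 + 1))
    (hfμ' : Function.Injective (fun a : κ => ((pμ' a, Sum.inr (mμ' a)) : Idx M' (Fib 3))))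
    (hcoarse' : ∀ (s : ↥(pbox M')) (m : Fin (3 + 1)),
      ((s, Sum.inr m) : Idx M' (Fib 3)) ∈ Set.range (fun a : κ => ((pμ' a, Sum.inr (mμ' a)) : Idx M' (Fib 3))) ↔ Torus.proj Lc (s : Site (3 + 1)) = 0)
    {H₀ : Matrix (↥(pbox (towerTorus Lc M' (n + 1))) × Fin (3 + 1)) (↥(pbox (towerTorus Lc M' (n + 1))) × Fin (3 + 1)) ℝ}
    {Q₁₀ : Matrix (↥(pbox M') × Fin (3 + 1)) (↥(pbox (towerTorus Lc M' (n + 1))) × Fin (3 + 1)) ℝ}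
    {τ₁ : Matrix (NParam Lc (fine Lc M') (fun k => (fun _ : ℕ => ctrOff (3 + 1) Lc) (k + 1)) n) (↥(pbox (towerTorus Lc M' (n + 1))) × Fin (3 + 1)) ℝ}
    (hH₀ : H₀ = (perF (towerTorus Lc M' (n + 1)) (bhKStepSh 3 Lc (Dsh Lc) (lev (n + 1)))).submatrix
        (fun b : ↥(pbox (towerTorus Lc M' (n + 1))) × Fin (3 + 1) => ((b.1, Sum.inl b.2) : Idx (towerTorus Lc M' (n + 1)) (Fib 3)))
        (fun b : ↥(pbox (towerTorus Lc M' (n + 1))) × Fin (3 + 1) => ((b.1, Sum.inl b.2) : Idx (towerTorus Lc M' (n + 1)) (Fib 3))))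
    (hQ₁₀ : Q₁₀ = compRowsSym Lc M' lev (fun _ : ℕ => ctrOff (3 + 1) Lc) (n + 1))
    (hτ₁ : τ₁ = bigP Lc (fine Lc M') (fun k => (fun _ : ℕ => ctrOff (3 + 1) Lc) (k + 1)) (fun k => toSite_mem_range (hrs (k + 1))) n)
    {τ₂ : Matrix (Res (toSite (ctrOff (3 + 1) Lc)) Lc M') (↥(pbox M') × Fin (3 + 1)) ℝ} (hτ₂ : τ₂ = combF Lc M' ((fun _ : ℕ => ctrOff (3 + 1) Lc) 0))
    {Q₂₀ : Matrix κ (↥(pbox M') × Fin (3 + 1)) ℝ}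
    (hQ₂₀ : Q₂₀ = (perF M' (bhKStepSh 3 Lc (Dsh Lc) (lev 0))).submatrix (fun a : κ => ((pμ' a, Sum.inr (mμ' a)) : Idx M' (Fib 3)))
        (fun b : ↥(pbox M') × Fin (3 + 1) => ((b.1, Sum.inl b.2) : Idx M' (Fib 3))))
    {W₀ : Matrix (↥(pbox (towerTorus Lc M' (n + 1))) × Fin (3 + 1)) (NParam Lc M' (fun _ : ℕ => ctrOff (3 + 1) Lc) (n + 1)) ℝ}
    (hW₀ : W₀ = towerGen Lc M' (fun _ : ℕ => ctrOff (3 + 1) Lc) (n + 1))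
    {P : Matrix (NParam Lc M' (fun _ : ℕ => ctrOff (3 + 1) Lc) (n + 1)) (↥(pbox (towerTorus Lc M' (n + 1))) × Fin (3 + 1)) ℝ}
    (hP : P = bigP Lc M' (fun _ : ℕ => ctrOff (3 + 1) Lc) (fun k => toSite_mem_range (hrs k)) (n + 1))
    {𝔔₀ : Matrix κ (↥(pbox (towerTorus Lc M' (n + 1))) × Fin (3 + 1)) ℝ} (h𝔔₀ : Q₂₀ * Q₁₀ = 𝔔₀)
    {I : Matrix (↥(pbox (towerTorus Lc M' (n + 1))) × Fin (3 + 1))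
      ((↥(pbox M') × Fin (3 + 1)) ⊕ NParam Lc (fine Lc M') (fun k => (fun _ : ℕ => ctrOff (3 + 1) Lc) (k + 1)) n) ℝ}
    {S : Matrix ((↥(pbox M') × Fin (3 + 1)) ⊕ NParam Lc (fine Lc M') (fun k => (fun _ : ℕ => ctrOff (3 + 1) Lc) (k + 1)) n)
      ((↥(pbox M') × Fin (3 + 1)) ⊕ NParam Lc (fine Lc M') (fun k => (fun _ : ℕ => ctrOff (3 + 1) Lc) (k + 1)) n) ℝ}
    (hI : minOp H₀ (fromRows Q₁₀ τ₁) = I) (hS : effForm H₀ (fromRows Q₁₀ τ₁) = S)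
    {hv : (κ → ℝ) → ((↥(pbox (towerTorus Lc M' (n + 1))) × Fin (3 + 1)) → ℝ)}
    (hhv : ∀ v, hv v = I *ᵥ Sum.elim (minOp S.toBlocks₁₁ (fromRows Q₂₀ τ₂) *ᵥ Sum.elim v 0) 0)
    {XN : Matrix ((↥(pbox (towerTorus Lc M' (n + 1))) × Fin (3 + 1)) ⊕ (κ ⊕ NParam Lc M' (fun _ : ℕ => ctrOff (3 + 1) Lc) (n + 1)))
      ((↥(pbox (towerTorus Lc M' (n + 1))) × Fin (3 + 1)) ⊕ (κ ⊕ NParam Lc M' (fun _ : ℕ => ctrOff (3 + 1) Lc) (n + 1))) ℝ}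
    (hXN : kkt H₀ (fromRows 𝔔₀ P) * XN = 1) 
    -- the two KKT non-degeneracies of the NESTED system (displayed; at the wrapper `h1` is `Matrix.isUnit_det_of_right_inverse` on the F leg `hXF`, `h2` is #21-GB's (EFF) line)
    (h1 : (kkt H₀ (fromRows Q₁₀ τ₁)).det ≠ 0) (h2 : (kkt S.toBlocks₁₁ (fromRows Q₂₀ τ₂)).det ≠ 0)
    (hTW : (Matrix.fromRows (τ₂ * Q₁₀) τ₁ * W₀).det ≠ 0)
    -- the coarse box and the leg letters for the record's chart
    (Mc : Fin (3 + 1) → ℕ) [∀ i, NeZero (Mc i)] (hMc : ∀ i, M' i = Lc * Mc i)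
    (σ : Fib 3 → ℝ) (ρN : Site (3 + 1)) (LNc : ℕ) (fN : κ → Idx (towerTorus Lc M' (n + 1)) (Fib 3))
    (slot : κ ≃ ↥(pbox Mc) × Fin (3 + 1))
    (hfN : ∀ a : κ, fN a = (wrapPt (towerTorus Lc M' (n + 1)) (((Lc ^ (n + 1 + 1) : ℕ) : ℤ) • ((slot a).1 : Site (3 + 1))), Sum.inr (slot a).2))
    (hEAN : perF (towerTorus Lc M' (n + 1)) (axEc ρN LNc) * perF (towerTorus Lc M' (n + 1)) (scaleK σ σ (AN R (n + 1))) = perF (towerTorus Lc M' (n + 1)) (scaleK σ σ (AN R (n + 1))))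
    (hLN : XN.submatrix (Sum.map id Sum.inl) (Sum.map id Sum.inl) = fromBlocks
      (Matrix.of fun (b b' : (↥(pbox (towerTorus Lc M' (n + 1))) × Fin (3 + 1))) =>
        axEc ρN LNc (b.1 : Site (3 + 1)) (b.1 : Site (3 + 1)) (Sum.inl b.2) (Sum.inl b.2)
          * (axEc ρN LNc (b'.1 : Site (3 + 1)) (b'.1 : Site (3 + 1)) (Sum.inl b'.2) (Sum.inl b'.2)
            * perF (towerTorus Lc M' (n + 1)) (scaleK σ σ (AN R (n + 1))) (b.1, Sum.inl b.2) (b'.1, Sum.inl b'.2)))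
      (Matrix.of fun (b : (↥(pbox (towerTorus Lc M' (n + 1))) × Fin (3 + 1))) (a : κ) =>
        axEc ρN LNc (b.1 : Site (3 + 1)) (b.1 : Site (3 + 1)) (Sum.inl b.2) (Sum.inl b.2) * perF (towerTorus Lc M' (n + 1)) (scaleK σ σ (AN R (n + 1))) (b.1, Sum.inl b.2) (fN a))
      (-Matrix.of fun (a : κ) (b : (↥(pbox (towerTorus Lc M' (n + 1))) × Fin (3 + 1))) =>
        axEc ρN LNc (b.1 : Site (3 + 1)) (b.1 : Site (3 + 1)) (Sum.inl b.2) (Sum.inl b.2) * perF (towerTorus Lc M' (n + 1)) (scaleK σ σ (AN R (n + 1))) (fN a) (b.1, Sum.inl b.2))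
      (-((perF (towerTorus Lc M' (n + 1)) (scaleK σ σ (AN R (n + 1)))).submatrix fN fN)))
    (μ : Fin (3 + 1)) :
    (P * W₀)⁻¹ *ᵥ (P *ᵥ hv (fun a : κ => if (slot a).2 = μ then (1 : ℝ) else 0)) = 0 := by
  have hθ := gaugeParam_eq_neg_nestedReadout_sym M' Lc lev n hrs hlev hM' pμ' mμ' hfμ' hcoarse' hH₀ hQ₁₀ hτ₁ hτ₂ hQ₂₀ hW₀ hP h𝔔₀ hI hS hhv hXN h1 h2
    (fun a : κ => if (slot a).2 = μ then (1 : ℝ) else 0)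
  have hLb : bigRatio Lc (n + 1) = Lc ^ (n + 1 + 1) := bigRatio_eq_pow Lc (n + 1)
  have hT : ∀ i, towerTorus Lc M' (n + 1) i = Lc ^ (n + 1 + 1) * Mc i := fun i => by
    rw [towerTorus_apply, hMc i]; ring
  exact gaugeParam_uniform_eq_zero_sym R (n + 1) M' lev (fun _ : ℕ => ctrOff (3 + 1) Lc) (fun k => toSite_mem_range (hrs k)) hM' n hLb Mc hT
    hQ₁₀ hτ₁ hτ₂ rfl hTW σ ρN LNc fN slot hfN hEAN hLN μ hθ

set_option synthInstance.maxSize 1024 in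
/-- [folklore] **`lv_uniform_eq_zero_at_pins` — THE TREE-GAUGE FUNCTION OF UNIFORM DATA VANISHES** (v10's `hlve` word): same binders + v10's `hlve`-shaped DISPLAY of `lv`
(`lv v s = −Σ_{x : Res} [x.1 = s]·(towerEvalC *ᵥ ((P·W₀)⁻¹ *ᵥ (P *ᵥ hv v)))(towerEquiv x)`): `lv 𝟙_μ s = 0` at every finest site `s` — K2L-LAM's «Λ_μ constant» on every box, the constant being `0`. -/
theorem lv_uniform_eq_zero_at_pins (R : Roots Lc)
    (hrs : ∀ _k : ℕ, ctrOff (3 + 1) Lc ∈ box (3 + 1) Lc)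
    (hlev : ∀ i, i ≤ n → lev i = lev (i + 1) + 1) (hM' : ∀ i, Lc ∣ M' i)
    {κ : Type*} [Fintype κ] [DecidableEq κ] (pμ' : κ → ↥(pbox M')) (mμ' : κ → Fin (3 + 1))
    (hfμ' : Function.Injective (fun a : κ => ((pμ' a, Sum.inr (mμ' a)) : Idx M' (Fib 3))))
    (hcoarse' : ∀ (s : ↥(pbox M')) (m : Fin (3 + 1)),
      ((s, Sum.inr m) : Idx M' (Fib 3)) ∈ Set.range (fun a : κ => ((pμ' a, Sum.inr (mμ' a)) : Idx M' (Fib 3))) ↔ Torus.proj Lc (s : Site (3 + 1)) = 0)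
    {H₀ : Matrix (↥(pbox (towerTorus Lc M' (n + 1))) × Fin (3 + 1)) (↥(pbox (towerTorus Lc M' (n + 1))) × Fin (3 + 1)) ℝ}
    {Q₁₀ : Matrix (↥(pbox M') × Fin (3 + 1)) (↥(pbox (towerTorus Lc M' (n + 1))) × Fin (3 + 1)) ℝ}
    {τ₁ : Matrix (NParam Lc (fine Lc M') (fun k => (fun _ : ℕ => ctrOff (3 + 1) Lc) (k + 1)) n) (↥(pbox (towerTorus Lc M' (n + 1))) × Fin (3 + 1)) ℝ}
    (hH₀ : H₀ = (perF (towerTorus Lc M' (n + 1)) (bhKStepSh 3 Lc (Dsh Lc) (lev (n + 1)))).submatrix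
        (fun b : ↥(pbox (towerTorus Lc M' (n + 1))) × Fin (3 + 1) => ((b.1, Sum.inl b.2) : Idx (towerTorus Lc M' (n + 1)) (Fib 3)))
        (fun b : ↥(pbox (towerTorus Lc M' (n + 1))) × Fin (3 + 1) => ((b.1, Sum.inl b.2) : Idx (towerTorus Lc M' (n + 1)) (Fib 3))))
    (hQ₁₀ : Q₁₀ = compRowsSym Lc M' lev (fun _ : ℕ => ctrOff (3 + 1) Lc) (n + 1))
    (hτ₁ : τ₁ = bigP Lc (fine Lc M') (fun k => (fun _ : ℕ => ctrOff (3 + 1) Lc) (k + 1)) (fun k => toSite_mem_range (hrs (k + 1))) n)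
    {τ₂ : Matrix (Res (toSite (ctrOff (3 + 1) Lc)) Lc M') (↥(pbox M') × Fin (3 + 1)) ℝ} (hτ₂ : τ₂ = combF Lc M' ((fun _ : ℕ => ctrOff (3 + 1) Lc) 0))
    {Q₂₀ : Matrix κ (↥(pbox M') × Fin (3 + 1)) ℝ}
    (hQ₂₀ : Q₂₀ = (perF M' (bhKStepSh 3 Lc (Dsh Lc) (lev 0))).submatrix (fun a : κ => ((pμ' a, Sum.inr (mμ' a)) : Idx M' (Fib 3)))
        (fun b : ↥(pbox M') × Fin (3 + 1) => ((b.1, Sum.inl b.2) : Idx M' (Fib 3))))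
    {W₀ : Matrix (↥(pbox (towerTorus Lc M' (n + 1))) × Fin (3 + 1)) (NParam Lc M' (fun _ : ℕ => ctrOff (3 + 1) Lc) (n + 1)) ℝ}
    (hW₀ : W₀ = towerGen Lc M' (fun _ : ℕ => ctrOff (3 + 1) Lc) (n + 1))
    {P : Matrix (NParam Lc M' (fun _ : ℕ => ctrOff (3 + 1) Lc) (n + 1)) (↥(pbox (towerTorus Lc M' (n + 1))) × Fin (3 + 1)) ℝ}
    (hP : P = bigP Lc M' (fun _ : ℕ => ctrOff (3 + 1) Lc) (fun k => toSite_mem_range (hrs k)) (n + 1))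
    {𝔔₀ : Matrix κ (↥(pbox (towerTorus Lc M' (n + 1))) × Fin (3 + 1)) ℝ} (h𝔔₀ : Q₂₀ * Q₁₀ = 𝔔₀)
    {I : Matrix (↥(pbox (towerTorus Lc M' (n + 1))) × Fin (3 + 1))
      ((↥(pbox M') × Fin (3 + 1)) ⊕ NParam Lc (fine Lc M') (fun k => (fun _ : ℕ => ctrOff (3 + 1) Lc) (k + 1)) n) ℝ}
    {S : Matrix ((↥(pbox M') × Fin (3 + 1)) ⊕ NParam Lc (fine Lc M') (fun k => (fun _ : ℕ => ctrOff (3 + 1) Lc) (k + 1)) n)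
      ((↥(pbox M') × Fin (3 + 1)) ⊕ NParam Lc (fine Lc M') (fun k => (fun _ : ℕ => ctrOff (3 + 1) Lc) (k + 1)) n) ℝ}
    (hI : minOp H₀ (fromRows Q₁₀ τ₁) = I) (hS : effForm H₀ (fromRows Q₁₀ τ₁) = S)
    {hv : (κ → ℝ) → ((↥(pbox (towerTorus Lc M' (n + 1))) × Fin (3 + 1)) → ℝ)}
    (hhv : ∀ v, hv v = I *ᵥ Sum.elim (minOp S.toBlocks₁₁ (fromRows Q₂₀ τ₂) *ᵥ Sum.elim v 0) 0)
    {XN : Matrix ((↥(pbox (towerTorus Lc M' (n + 1))) × Fin (3 + 1)) ⊕ (κ ⊕ NParam Lc M' (fun _ : ℕ => ctrOff (3 + 1) Lc) (n + 1)))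
      ((↥(pbox (towerTorus Lc M' (n + 1))) × Fin (3 + 1)) ⊕ (κ ⊕ NParam Lc M' (fun _ : ℕ => ctrOff (3 + 1) Lc) (n + 1))) ℝ}
    (hXN : kkt H₀ (fromRows 𝔔₀ P) * XN = 1) 
    -- the two KKT non-degeneracies of the NESTED system (displayed; at the wrapper `h1` is `Matrix.isUnit_det_of_right_inverse` on the F leg `hXF`, `h2` is #21-GB's (EFF) line)
    (h1 : (kkt H₀ (fromRows Q₁₀ τ₁)).det ≠ 0) (h2 : (kkt S.toBlocks₁₁ (fromRows Q₂₀ τ₂)).det ≠ 0)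
    (hTW : (Matrix.fromRows (τ₂ * Q₁₀) τ₁ * W₀).det ≠ 0)
    (Mc : Fin (3 + 1) → ℕ) [∀ i, NeZero (Mc i)] (hMc : ∀ i, M' i = Lc * Mc i)
    (σ : Fib 3 → ℝ) (ρN : Site (3 + 1)) (LNc : ℕ) (fN : κ → Idx (towerTorus Lc M' (n + 1)) (Fib 3))
    (slot : κ ≃ ↥(pbox Mc) × Fin (3 + 1))
    (hfN : ∀ a : κ, fN a = (wrapPt (towerTorus Lc M' (n + 1)) (((Lc ^ (n + 1 + 1) : ℕ) : ℤ) • ((slot a).1 : Site (3 + 1))), Sum.inr (slot a).2))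
    (hEAN : perF (towerTorus Lc M' (n + 1)) (axEc ρN LNc) * perF (towerTorus Lc M' (n + 1)) (scaleK σ σ (AN R (n + 1))) = perF (towerTorus Lc M' (n + 1)) (scaleK σ σ (AN R (n + 1))))
    (hLN : XN.submatrix (Sum.map id Sum.inl) (Sum.map id Sum.inl) = fromBlocks
      (Matrix.of fun (b b' : (↥(pbox (towerTorus Lc M' (n + 1))) × Fin (3 + 1))) =>
        axEc ρN LNc (b.1 : Site (3 + 1)) (b.1 : Site (3 + 1)) (Sum.inl b.2) (Sum.inl b.2)
          * (axEc ρN LNc (b'.1 : Site (3 + 1)) (b'.1 : Site (3 + 1)) (Sum.inl b'.2) (Sum.inl b'.2)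
            * perF (towerTorus Lc M' (n + 1)) (scaleK σ σ (AN R (n + 1))) (b.1, Sum.inl b.2) (b'.1, Sum.inl b'.2)))
      (Matrix.of fun (b : (↥(pbox (towerTorus Lc M' (n + 1))) × Fin (3 + 1))) (a : κ) =>
        axEc ρN LNc (b.1 : Site (3 + 1)) (b.1 : Site (3 + 1)) (Sum.inl b.2) (Sum.inl b.2) * perF (towerTorus Lc M' (n + 1)) (scaleK σ σ (AN R (n + 1))) (b.1, Sum.inl b.2) (fN a))
      (-Matrix.of fun (a : κ) (b : (↥(pbox (towerTorus Lc M' (n + 1))) × Fin (3 + 1))) =>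
        axEc ρN LNc (b.1 : Site (3 + 1)) (b.1 : Site (3 + 1)) (Sum.inl b.2) (Sum.inl b.2) * perF (towerTorus Lc M' (n + 1)) (scaleK σ σ (AN R (n + 1))) (fN a) (b.1, Sum.inl b.2))
      (-((perF (towerTorus Lc M' (n + 1)) (scaleK σ σ (AN R (n + 1)))).submatrix fN fN)))
    -- v10's `hlve`-shaped DISPLAY of the tree-gauge function
    (lv : (κ → ℝ) → (↥(pbox (towerTorus Lc M' (n + 1))) → ℝ))
    (hlve : ∀ (v : κ → ℝ) (s : ↥(pbox (towerTorus Lc M' (n + 1)))), lv v s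
      = -(∑ x : Res (bigRoot Lc (fun _ : ℕ => ctrOff (3 + 1) Lc) (n + 1)) (bigRatio Lc (n + 1)) (towerTorus Lc M' (n + 1)),
          (if (x.1 : ↥(pbox (towerTorus Lc M' (n + 1)))) = s then
            (towerEvalC Lc M' (fun _ : ℕ => ctrOff (3 + 1) Lc) (fun k => toSite_mem_range (hrs k)) (n + 1)
              *ᵥ ((P * W₀)⁻¹ *ᵥ (P *ᵥ hv v))) (towerEquiv Lc M' (fun _ : ℕ => ctrOff (3 + 1) Lc) (fun k => toSite_mem_range (hrs k)) (n + 1) x) else 0)))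
    (μ : Fin (3 + 1)) (s : ↥(pbox (towerTorus Lc M' (n + 1)))) :
    lv (fun a : κ => if (slot a).2 = μ then (1 : ℝ) else 0) s = 0 := by
  rw [hlve, gaugeParam_uniform_eq_zero_at_pins M' Lc lev n R hrs hlev hM' pμ' mμ' hfμ' hcoarse' hH₀ hQ₁₀ hτ₁ hτ₂ hQ₂₀ hW₀ hP h𝔔₀ hI hS hhv hXN h1 h2 hTW
    Mc hMc σ ρN LNc fN slot hfN hEAN hLN μ, Matrix.mulVec_zero]
  simp

end Pins

end Summit.QuantumFields.BalabanUV.Beta.FP.TowerDoorUniformDataWrapper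

end
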